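import Summits.ResolutionOfSingularities.ResolutionOfSingularities.Theorems.DescentDescentPerfectToAllExhaustion
import Mathlib.FieldTheory.SeparablyGenerated
import Mathlib.FieldTheory.PurelyInseparable.PerfectClosure
import Mathlib.RingTheory.AlgebraicIndependent.Adjoin
import Mathlib.RingTheory.AlgebraicIndependent.TranscendenceBasis
import Mathlib.Algebra.MvPolynomial.Equiv
import Mathlib.Algebra.Polynomial.Degree.Domain
import Mathlib.FieldTheory.RatFunc.Degree
import Mathlib.Algebra.Algebra.ZMod
import HarnessLib

/-!
# [OURS · L1 W8.2] OUTSIDE THE REACH OF THE PRIME FIELD: a perfect field containing a transcendental is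
# separable over NONE of its finitely generated subfields — the residual fields of door 1 lie outside the reach

Cell `res-hironaka` (run/shared/lean/pub/res-hironaka/), LADDER-RESOLUTION rung L (RESCUE), slot W8.2; host route
`UniversalCells`, host item `PrimeFieldToPerfect` (stmt-ResolutionOfSingularities-15233), door 1. Proofs file
(Theses-free, field theory only), written by res-L1-s82-pv-1 (gen 5); companion of `…PrimeFieldReach.lean` (whose
docstring announces this file under the earlier name `…PrimeFieldReachNegative.lean`; the
positive side: resolution over the finitely generated subfields of `k` gives resolution over `k` whenever `k` is
*separably exhausted by finitely generated subfields* — every finite subset inside a finitely generated `L ⊆ k` with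
`k / L` separable in Mac Lane's sense).

* `exists_pow_eq_of_linearIndepOn_pow_of_perfect` — **Mac Lane separability of a PERFECT field `k` over a subfield
  `L` forces `L` to be perfect**: for `a ∈ L` and `b = a^{1/p} ∈ k`, if `b ∉ L` then `{1, b}` is `L`-free while
  `{1, b}^p = {1, a}` is not.
* `exists_not_pow_of_eq_closure_of_transcendental` — **a finitely generated field containing a transcendental is not
  perfect**: by the separating transcendence basis over the (perfect) prime field (Mathlib,
  `exists_isTranscendenceBasis_and_isSeparable_of_perfectField`) a non-empty algebraically independent `s` has
  `L / 𝔽_p(s)` separable algebraic, and an element of `s` has no `p`-th root in `L`: such a root would be separable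
  and purely inseparable over `𝔽_p(s)`, hence in `𝔽_p(s) ≅ Frac 𝔽_p[X_s]`, where a variable is not a `p`-th power
  (`pow_ne_algebraMap_X_fractionRing_mvPolynomial`, degree count).
* `not_separablyExhausted_of_perfectField_of_transcendental` — hence **NO perfect field containing a transcendental
  is separably exhausted by finitely generated subfields**; in particular (`…_of_isPurelyInseparable_ratFunc`,
  `…_of_isPurelyInseparable_fractionRing_mvPolynomial`, with a direct proof avoiding transcendence bases) the fields of
  door 1's normal forms — `M(t)^{perf}` (`PerfectionStepAt M n`), the rational tower `(𝔽_p(t_ι))^{perf}`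
  (`…PinnedTowerLinks`), the one field `Ω₁(p) = (𝔽_p(x_ℕ))^{perf}` (`primeFieldToPerfect_iff_oneField`).

Read with the positive side: from door 1's antecedent (resolution over `𝔽_p`, hence over every finitely generated
field — half (a)), the generic-fibre-plus-separable-ascent mechanism reaches a perfect field EXACTLY WHEN it is
algebraic over `𝔽_p` (those are separable algebraic over the finite field `closure ∅`); every perfect field of
positive transcendence degree — the whole content of the crux `PrimeFieldToPerfect` beyond half (a) — is outside.
This is the by-name form of the slot's barrier reading («transfer must be of FAMILIES with regular total space, not
of fibres»: fibres only travel along separable extensions, and `K^{perf} / K` is separable over no finitely generated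
level).

HONEST FRAMING. OURS theorems (role replaced: §17 ¶2 p.89 l.59–62 of [Hironaka2017], typed AS PRINTED as
`S17Methodology.U89_3`); NOT statements of the manuscript; nothing attributed to its author; no typed candidate used.
Classical field theory (Mac Lane 1939; Matsumura, Commutative Ring Theory §26); nothing here is progress on the open
residual. AI work, weaker than expert review; no claim beyond the kernel.
-/

noncomputable section

set_option linter.dupNamespace false -- mandated namespace of this single-conjunct summit

open Polynomial

namespace Summit.ResolutionOfSingularities.ResolutionOfSingularities.Theorems.CampaignW82

/-! ## §1 Mac Lane separability of a perfect field over `L` forces `L` perfect -/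

/-- **Mac Lane separability of a perfect field over a subfield forces the subfield to be perfect.** Let `k` be a
field of characteristic `p` in which every element is a `p`-th power, `L ⊆ k` a subfield such that `L`-linearly
independent finite families of `k` have `L`-linearly independent `p`-th powers. Then every `a ∈ L` is the `p`-th
power of an element of `L`: if `b^p = a` with `b ∉ L`, the pair `{1, b}` is `L`-free but `{1^p, b^p} = {1, a}`
satisfies `a · 1 − 1 · a = 0`. [cite: Matsumura1987, §26 Thm. 26.4] -/
theorem exists_pow_eq_of_linearIndepOn_pow_of_perfect {p : ℕ} [Fact p.Prime] {k : Type} [Field k] [CharP k p]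
    (hk : ∀ x : k, ∃ y : k, y ^ p = x) (L : Subfield k)
    (hML : ∀ u : Finset k, LinearIndepOn L _root_.id (↑u : Set k) →
      LinearIndepOn L (fun x : k => x ^ p) (↑u : Set k))
    {a : k} (ha : a ∈ L) : ∃ b ∈ L, b ^ p = a := by
  classical
  have hp : p.Prime := Fact.out
  obtain ⟨b, hb⟩ := hk a
  by_cases hbL : b ∈ L
  · exact ⟨b, hbL, hb⟩
  exfalso
  have h1b : (1 : k) ≠ b := fun h => hbL (h ▸ L.one_mem)
  -- `{1, b}` is `L`-linearly independent
  have hind : LinearIndepOn L _root_.id (↑({1, b} : Finset k) : Set k) := by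
    rw [Finset.coe_pair, LinearIndepOn.pair_iff _ h1b]
    intro c d hcd
    simp only [_root_.id, Subfield.smul_def, smul_eq_mul, mul_one] at hcd
    by_cases hd : (d : k) = 0
    · rw [hd, zero_mul, add_zero] at hcd
      exact ⟨Subtype.ext hcd, Subtype.ext hd⟩
    · exfalso
      apply hbL
      have hbeq : b = -(c : k) / (d : k) := by
        field_simp
        linear_combination hcd
      rw [hbeq]
      exact L.div_mem (L.neg_mem c.2) d.2
  -- but `{1^p, b^p} = {1, a}` is not
  have hdep := hML _ hind
  rw [Finset.coe_pair, LinearIndepOn.pair_iff _ h1b] at hdep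
  have h := hdep (-⟨a, ha⟩) 1 (by
    simp only [Subfield.smul_def, smul_eq_mul, one_pow, hb, Subfield.coe_neg, Subfield.coe_one]
    ring)
  exact one_ne_zero h.2

/-- **A perfect field is separably exhausted by finitely generated subfields only through PERFECT finitely generated
levels**: if some finite `s ⊆ k` lies in no relatively perfect finitely generated subfield, `k` is not separably
exhausted by finitely generated subfields. (Contrapositive packaging of the previous lemma.) [folklore] -/
theorem not_separablyExhausted_of_perfect {p : ℕ} [Fact p.Prime] {k : Type} [Field k] [CharP k p]
    (hk : ∀ x : k, ∃ y : k, y ^ p = x) (s : Finset k)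
    (hs : ∀ (L : Subfield k) (t : Finset k), L = Subfield.closure (↑t : Set k) → (↑s : Set k) ⊆ L →
      ∃ a ∈ L, ∀ b ∈ L, b ^ p ≠ a) :
    ¬ ∀ s : Finset k, ∃ (L : Subfield k) (t : Finset k), L = Subfield.closure (↑t : Set k) ∧
      (↑s : Set k) ⊆ L ∧ ∀ u : Finset k, LinearIndepOn L _root_.id (↑u : Set k) →
        LinearIndepOn L (fun x : k => x ^ p) (↑u : Set k) := by
  intro h
  obtain ⟨L, t, hL, hsL, hML⟩ := h s
  obtain ⟨a, ha, hna⟩ := hs L t hL hsL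
  obtain ⟨b, hb, hba⟩ := exists_pow_eq_of_linearIndepOn_pow_of_perfect hk L hML ha
  exact hna b hb hba

/-- In a perfect field of characteristic `p` every element is a `p`-th power (pointwise form used above).
[folklore] -/
theorem forall_exists_pow_eq_of_perfectField (p : ℕ) [Fact p.Prime] (k : Type) [Field k] [CharP k p]
    [PerfectField k] : ∀ x : k, ∃ y : k, y ^ p = x := by
  have hp : p.Prime := Fact.out
  haveI : ExpChar k p := ExpChar.prime hp
  haveI : PerfectRing k p := PerfectField.toPerfectRing p
  intro x
  obtain ⟨y, hy⟩ := surjective_frobenius k p x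
  exact ⟨y, by rw [← frobenius_def]; exact hy⟩

/-! ## §2 Variables are not `p`-th powers in rational function fields -/

/-- `X` is not a `p`-th power in `M(X)` (`p ≥ 2`): degrees. [folklore] -/
theorem pow_ne_X_ratFunc {p : ℕ} (hp : 2 ≤ p) (M : Type) [Field M] (f : RatFunc M) : f ^ p ≠ RatFunc.X := by
  intro h
  have hf : f ≠ 0 := by
    rintro rfl
    rw [zero_pow (by omega)] at h
    exact RatFunc.X_ne_zero h.symm
  have hdeg : ∀ n : ℕ, RatFunc.intDegree (f ^ n) = n * RatFunc.intDegree f := by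
    intro n
    induction n with
    | zero => simp [RatFunc.intDegree_one]
    | succ n ih =>
      rw [pow_succ, RatFunc.intDegree_mul (pow_ne_zero n hf) hf, ih]
      push_cast
      ring
  have h1 := hdeg p
  rw [h, RatFunc.intDegree_X] at h1
  have hdvd : (p : ℤ) ∣ 1 := ⟨RatFunc.intDegree f, h1⟩
  have : (p : ℤ) ≤ 1 := Int.le_of_dvd one_pos hdvd
  omega

/-- In a polynomial ring over a domain, `A ^ p = X * B ^ p` forces `B = 0` (`p ≥ 2`): degrees modulo `p`.
[folklore] -/
theorem eq_zero_of_pow_eq_X_mul_pow {p : ℕ} (hp : 2 ≤ p) {D : Type} [CommRing D] [IsDomain D]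
    {A B : D[X]} (h : A ^ p = Polynomial.X * B ^ p) : B = 0 := by
  by_contra hB
  have hBp : B ^ p ≠ 0 := pow_ne_zero p hB
  have hA : A ≠ 0 := by
    rintro rfl
    rw [zero_pow (by omega)] at h
    exact (mul_ne_zero Polynomial.X_ne_zero hBp) h.symm
  have hdeg := congrArg Polynomial.natDegree h
  rw [Polynomial.natDegree_pow, Polynomial.natDegree_mul Polynomial.X_ne_zero hBp, Polynomial.natDegree_X,
    Polynomial.natDegree_pow] at hdeg
  have h1 : p ∣ 1 + p * B.natDegree := hdeg ▸ dvd_mul_right p A.natDegree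
  have h2 : p ∣ 1 := (Nat.dvd_add_left (dvd_mul_right p B.natDegree)).mp h1
  have h3 : p ≤ 1 := Nat.le_of_dvd one_pos h2
  omega

/-- **A variable is not a `p`-th power in `Frac F[X_ι]`** (`p ≥ 2`, `F` a field): if `z^p = X_i` with
`z = a/b`, then `a^p = X_i b^p` in `F[X_ι] ≅ (F[X_j : j ≠ i])[X_i]`, impossible by degrees in `X_i`. [folklore] -/
theorem pow_ne_algebraMap_X_fractionRing_mvPolynomial {p : ℕ} (hp : 2 ≤ p) (F : Type) [Field F] {ι : Type}
    (i : ι) (z : FractionRing (MvPolynomial ι F)) :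
    z ^ p ≠ algebraMap (MvPolynomial ι F) (FractionRing (MvPolynomial ι F)) (MvPolynomial.X i) := by
  classical
  intro hz
  -- write `z = a / b`
  obtain ⟨a, b, hb, hzab⟩ := IsFractionRing.div_surjective (A := MvPolynomial ι F) z
  have hb0 : (b : MvPolynomial ι F) ≠ 0 := nonZeroDivisors.ne_zero hb
  have hbK : algebraMap (MvPolynomial ι F) (FractionRing (MvPolynomial ι F)) b ≠ 0 := fun h =>
    hb0 ((IsFractionRing.injective (MvPolynomial ι F) (FractionRing (MvPolynomial ι F))) (by rw [h, map_zero]))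
  -- clear denominators: `a ^ p = X_i * b ^ p`
  have hab : a ^ p = MvPolynomial.X i * b ^ p := by
    apply IsFractionRing.injective (MvPolynomial ι F) (FractionRing (MvPolynomial ι F))
    rw [map_pow, map_mul, map_pow, ← hz, ← hzab, div_pow, div_mul_cancel₀ _ (pow_ne_zero p hbK)]
  -- move to `(F[X_j : j ≠ i])[X]`
  let Ψ : MvPolynomial ι F ≃ₐ[F] Polynomial (MvPolynomial {j // j ≠ i} F) :=
    (MvPolynomial.renameEquiv F (Equiv.optionSubtypeNe i).symm).trans (MvPolynomial.optionEquivLeft F {j // j ≠ i})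
  have hΨX : Ψ (MvPolynomial.X i) = Polynomial.X := by
    simp only [Ψ, AlgEquiv.trans_apply]
    change MvPolynomial.optionEquivLeft F {j // j ≠ i}
      (MvPolynomial.rename (Equiv.optionSubtypeNe i).symm (MvPolynomial.X i)) = Polynomial.X
    rw [MvPolynomial.rename_X, Equiv.optionSubtypeNe_symm_self, MvPolynomial.optionEquivLeft_X_none]
  have h' : Ψ a ^ p = Polynomial.X * Ψ b ^ p := by
    rw [← map_pow, hab, map_mul, map_pow, hΨX]
  have hΨb : Ψ b = 0 := eq_zero_of_pow_eq_X_mul_pow hp h'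
  exact hb0 (by simpa using congrArg Ψ.symm hΨb)

/-! ## §3 Finitely generated fields containing a transcendental are not perfect -/

/-- **A finitely generated field containing a transcendental is not relatively perfect.** Let `L = closure t` be a
finitely generated subfield of a field `k` of characteristic `p`, containing an element `x` transcendental over the
prime field. Then some `a ∈ L` has no `p`-th root in `L`. PROOF: `L / 𝔽_p` is finitely generated over the perfect
`𝔽_p`, so it has a separating transcendence basis `s` (Mathlib); `s ≠ ∅` since `x` is transcendental; for `y ∈ s`
a `p`-th root `b ∈ L` of `y` would be separable AND purely inseparable over `𝔽_p(s)`, so `b ∈ 𝔽_p(s)`, and then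
`y = X_y` would be a `p`-th power in `𝔽_p(s) ≅ Frac 𝔽_p[X_s]` — it is not.
[cite: Matsumura1987, §26 Thm. 26.8] -/
theorem exists_not_pow_of_eq_closure_of_transcendental (p : ℕ) [Fact p.Prime] (k : Type) [Field k] [CharP k p]
    [Algebra (ZMod p) k] (L : Subfield k) (t : Finset k) (hL : L = Subfield.closure (↑t : Set k)) {x : k}
    (hxL : x ∈ L) (hx : Transcendental (ZMod p) x) : ∃ a ∈ L, ∀ b ∈ L, b ^ p ≠ a := by
  classical
  have hp : p.Prime := Fact.out
  haveI : CharP L p := L.subtype.charP Subtype.val_injective p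
  haveI : ExpChar L p := ExpChar.prime hp
  letI : Algebra (ZMod p) L := ZMod.algebra L p
  haveI : Algebra.EssFiniteType (ZMod p) L := essFiniteType_zmod_of_eq_closure L t hL
  -- `x` is transcendental in `L`
  have hx' : Transcendental (ZMod p) (⟨x, hxL⟩ : L) := by
    refine Transcendental.of_ringHom_of_comp_eq (RingHom.id (ZMod p)) L.subtype (a := (⟨x, hxL⟩ : L)) ?_
      (RingHom.id (ZMod p)).injective (Subsingleton.elim _ _)
    exact hx
  haveI : Algebra.Transcendental (ZMod p) L := ⟨⟨_, hx'⟩⟩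
  -- a separating transcendence basis of `L / 𝔽_p`, non-empty
  obtain ⟨s, hs, hsep⟩ := exists_isTranscendenceBasis_and_isSeparable_of_perfectField (ZMod p) L
  obtain ⟨⟨y, hy⟩⟩ := hs.nonempty_iff_transcendental.mpr inferInstance
  refine ⟨(y : k), y.2, fun b hb hby => ?_⟩
  -- a `p`-th root `b ∈ L` of `y`
  have hby' : (⟨b, hb⟩ : L) ^ p = y := Subtype.ext hby
  have hrange : (↑s : Set L) = Set.range ((↑) : ↥s → L) := Subtype.range_coe.symm
  rw [hrange] at hsep
  set E := IntermediateField.adjoin (ZMod p) (Set.range ((↑) : ↥s → L)) with hEdef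
  have hyE : (y : L) ∈ E := IntermediateField.subset_adjoin _ _ ⟨⟨y, hy⟩, rfl⟩
  -- `⟨b⟩` is purely inseparable and separable over `E`, hence in `E`
  have hperf : (⟨b, hb⟩ : L) ∈ perfectClosure E L := by
    rw [mem_perfectClosure_iff_pow_mem p]
    exact ⟨1, RingHom.mem_range.mpr ⟨⟨y, hyE⟩, by rw [pow_one, hby']; rfl⟩⟩
  have hsepb : (⟨b, hb⟩ : L) ∈ separableClosure E L :=
    mem_separableClosure_iff.mpr (Algebra.IsSeparable.isSeparable E _)
  have hbot : (⟨b, hb⟩ : L) ∈ (⊥ : IntermediateField E L) := by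
    rw [← separableClosure_inf_perfectClosure E L]
    exact IntermediateField.mem_inf.mpr ⟨hsepb, hperf⟩
  rw [IntermediateField.mem_bot] at hbot
  obtain ⟨e, he⟩ := hbot
  have hep : e ^ p = ⟨y, hyE⟩ := by
    apply (algebraMap E L).injective
    rw [map_pow, he, hby']
    rfl
  -- `E ≅ Frac 𝔽_p[X_s]` with `y ↦ X_⟨y⟩`
  have hφX : hs.1.aevalEquivField (algebraMap (MvPolynomial ↥s (ZMod p))
      (FractionRing (MvPolynomial ↥s (ZMod p))) (MvPolynomial.X (⟨y, hy⟩ : ↥s))) = ⟨y, hyE⟩ := by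
    apply Subtype.ext
    rw [AlgebraicIndependent.aevalEquivField_algebraMap_apply_coe, MvPolynomial.aeval_X]
  have hw : (hs.1.aevalEquivField.symm e) ^ p = algebraMap (MvPolynomial ↥s (ZMod p))
      (FractionRing (MvPolynomial ↥s (ZMod p))) (MvPolynomial.X (⟨y, hy⟩ : ↥s)) := by
    have h1 : hs.1.aevalEquivField.symm (e ^ p) = (hs.1.aevalEquivField.symm e) ^ p :=
      map_pow hs.1.aevalEquivField.symm e p
    rw [← h1, hep, ← hφX, AlgEquiv.symm_apply_apply]
  exact (pow_ne_algebraMap_X_fractionRing_mvPolynomial (p := p) hp.two_le (ZMod p) (ι := ↥s) ⟨y, hy⟩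
    (hs.1.aevalEquivField.symm e)) hw

/-- **NO PERFECT FIELD CONTAINING A TRANSCENDENTAL IS SEPARABLY EXHAUSTED BY FINITELY GENERATED SUBFIELDS.** For a
perfect field `k` of characteristic `p` and `x ∈ k` transcendental over the prime field, there is NO finitely
generated subfield `L ∋ x` over which `k` is separable in Mac Lane's sense (such an `L` would be perfect by
`exists_pow_eq_of_linearIndepOn_pow_of_perfect`, and it is not by
`exists_not_pow_of_eq_closure_of_transcendental`). So the reach of door 1's mechanism
(`…PrimeFieldReach.hasResolution_of_fgLevelRes_of_separablyExhausted`) contains no perfect field of positive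
transcendence degree. [cite: Matsumura1987, §26 Thm. 26.4 and Thm. 26.8] -/
theorem not_separablyExhausted_of_perfectField_of_transcendental (p : ℕ) [Fact p.Prime] (k : Type) [Field k]
    [CharP k p] [PerfectField k] [Algebra (ZMod p) k] {x : k} (hx : Transcendental (ZMod p) x) :
    ¬ ∀ s : Finset k, ∃ (L : Subfield k) (t : Finset k), L = Subfield.closure (↑t : Set k) ∧
      (↑s : Set k) ⊆ L ∧ ∀ u : Finset k, LinearIndepOn L _root_.id (↑u : Set k) →
        LinearIndepOn L (fun x : k => x ^ p) (↑u : Set k) := by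
  classical
  refine not_separablyExhausted_of_perfect (forall_exists_pow_eq_of_perfectField p k) {x}
    fun L t hL hxL => ?_
  exact exists_not_pow_of_eq_closure_of_transcendental p k L t hL (hxL (by simp)) hx

/-! ## §4 The residual fields of door 1 are outside the reach (direct proofs, no transcendence bases) -/

/-- **Finitely generated subfields of a purely inseparable extension of `F` meeting a non-`p`-th-power of `F` are not
perfect.** Let `k / F` be purely inseparable (characteristic `p`), `c ∈ F` with no `p`-th root in `F`, and
`L = closure t ⊆ k` finitely generated with `c ∈ L`. Then some element of `L` has no `p`-th root in `L`: all of
`L` is killed into `F` by one power `Frob^N` (finitely many generators, each purely inseparable over `F`), so a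
`p^{N+1}`-th root of `c` in `L` would give a `p`-th root of `c` in `F`. [folklore] -/
theorem exists_not_pow_of_eq_closure_of_isPurelyInseparable (p : ℕ) [Fact p.Prime] (F k : Type) [Field F]
    [Field k] [CharP F p] [Algebra F k] [IsPurelyInseparable F k] (c : F) (hc : ∀ f : F, f ^ p ≠ c)
    (L : Subfield k) (t : Finset k) (hL : L = Subfield.closure (↑t : Set k))
    (hcL : algebraMap F k c ∈ L) : ∃ a ∈ L, ∀ b ∈ L, b ^ p ≠ a := by
  classical
  have hp : p.Prime := Fact.out
  haveI : ExpChar F p := ExpChar.prime hp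
  haveI : CharP k p := charP_of_injective_algebraMap (algebraMap F k).injective p
  haveI : ExpChar k p := ExpChar.prime hp
  -- suppose, for contradiction, that `L` is relatively perfect
  by_contra hcon'
  have hcon : ∀ a ∈ L, ∃ b ∈ L, b ^ p = a := by
    intro a ha
    by_contra h
    exact hcon' ⟨a, ha, fun b hb hba => h ⟨b, hb, hba⟩⟩
  -- one Frobenius power `N` kills all of `L` into `F`
  have hgen : ∀ y ∈ (↑t : Set k), ∃ n : ℕ, y ^ p ^ n ∈ (algebraMap F k).range :=
    fun y _ => IsPurelyInseparable.pow_mem F p y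
  choose! n hn using hgen
  set N := t.sup n with hN
  let S : Subfield k := Subfield.comap (iterateFrobenius k p N) (algebraMap F k).fieldRange
  have htS : (↑t : Set k) ⊆ S := by
    intro y hy
    change (iterateFrobenius k p N) y ∈ (algebraMap F k).fieldRange
    rw [iterateFrobenius_def]
    obtain ⟨f, hf⟩ := hn y hy
    have hle : n y ≤ N := Finset.le_sup (f := n) hy
    obtain ⟨d, hd⟩ := Nat.exists_eq_add_of_le hle
    refine ⟨f ^ p ^ d, ?_⟩
    rw [map_pow, hf, hd, pow_add, pow_mul]
  have hLS : L ≤ S := by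
    rw [hL]
    exact Subfield.closure_le.mpr htS
  -- a `p^m`-th root of `c` in `L`, for every `m`
  have hroot : ∀ m : ℕ, ∃ b ∈ L, b ^ p ^ m = algebraMap F k c := by
    intro m
    induction m with
    | zero => exact ⟨_, hcL, by rw [pow_zero, pow_one]⟩
    | succ m ih =>
      obtain ⟨b, hb, hbc⟩ := ih
      obtain ⟨b', hb', hb'b⟩ := hcon b hb
      exact ⟨b', hb', by rw [pow_succ', pow_mul, hb'b, hbc]⟩
  obtain ⟨b, hb, hbc⟩ := hroot (N + 1)
  have hbS : b ∈ S := hLS hb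
  change (iterateFrobenius k p N) b ∈ (algebraMap F k).fieldRange at hbS
  rw [iterateFrobenius_def, RingHom.mem_fieldRange] at hbS
  obtain ⟨f, hf⟩ := hbS
  apply hc f
  apply (algebraMap F k).injective
  rw [map_pow, hf, ← pow_mul, ← pow_succ, hbc]

/-- **`M(t)^{perf}` is outside the reach.** A perfect field `k` purely inseparable over `RatFunc M` (the fields of
door 1's normal form `PerfectionStepAt M n`) is NOT separably exhausted by finitely generated subfields: `t = X` has
no `p`-th root in `M(t)` (`pow_ne_X_ratFunc`). [cite: Matsumura1987, §26 Thm. 26.4] -/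
theorem not_separablyExhausted_of_isPurelyInseparable_ratFunc (p : ℕ) [Fact p.Prime] (M : Type) [Field M]
    [CharP M p] (k : Type) [Field k] [PerfectField k] [Algebra (RatFunc M) k]
    [IsPurelyInseparable (RatFunc M) k] [CharP k p] :
    ¬ ∀ s : Finset k, ∃ (L : Subfield k) (t : Finset k), L = Subfield.closure (↑t : Set k) ∧
      (↑s : Set k) ⊆ L ∧ ∀ u : Finset k, LinearIndepOn L _root_.id (↑u : Set k) →
        LinearIndepOn L (fun x : k => x ^ p) (↑u : Set k) := by
  classical
  have hp : p.Prime := Fact.out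
  refine not_separablyExhausted_of_perfect (forall_exists_pow_eq_of_perfectField p k)
    {algebraMap (RatFunc M) k RatFunc.X} fun L t hL hsL => ?_
  exact exists_not_pow_of_eq_closure_of_isPurelyInseparable p (RatFunc M) k RatFunc.X
    (pow_ne_X_ratFunc hp.two_le M) L t hL (hsL (by simp))

/-- **`(F(x_ι))^{perf}` is outside the reach.** A perfect field `k` purely inseparable over `Frac F[x_ι]` with `ι`
non-empty (the RATIONAL TOWER of `…PinnedTowerLinks`, `F = 𝔽_p`, `ι` finite non-empty; the ONE FIELD `Ω₁(p)` of
`primeFieldToPerfect_iff_oneField`, `ι = ℕ`) is NOT separably exhausted by finitely generated subfields: a variable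
has no `p`-th root in `Frac F[x_ι]` (`pow_ne_algebraMap_X_fractionRing_mvPolynomial`).
[cite: Matsumura1987, §26 Thm. 26.4] -/
theorem not_separablyExhausted_of_isPurelyInseparable_fractionRing_mvPolynomial (p : ℕ) [Fact p.Prime]
    (F : Type) [Field F] [CharP F p] (ι : Type) [Nonempty ι] (k : Type) [Field k] [PerfectField k]
    [Algebra (FractionRing (MvPolynomial ι F)) k] [IsPurelyInseparable (FractionRing (MvPolynomial ι F)) k]
    [CharP k p] :
    ¬ ∀ s : Finset k, ∃ (L : Subfield k) (t : Finset k), L = Subfield.closure (↑t : Set k) ∧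
      (↑s : Set k) ⊆ L ∧ ∀ u : Finset k, LinearIndepOn L _root_.id (↑u : Set k) →
        LinearIndepOn L (fun x : k => x ^ p) (↑u : Set k) := by
  classical
  have hp : p.Prime := Fact.out
  obtain ⟨i⟩ := ‹Nonempty ι›
  set R := MvPolynomial ι F
  set K := FractionRing (MvPolynomial ι F)
  haveI : CharP K p := charP_of_injective_algebraMap (IsFractionRing.injective R K) p
  refine not_separablyExhausted_of_perfect (forall_exists_pow_eq_of_perfectField p k)
    {algebraMap K k (algebraMap R K (MvPolynomial.X i))} fun L t hL hsL => ?_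
  exact exists_not_pow_of_eq_closure_of_isPurelyInseparable p K k (algebraMap R K (MvPolynomial.X i))
    (fun f => pow_ne_algebraMap_X_fractionRing_mvPolynomial hp.two_le F i f) L t hL (hsL (by simp))

/-- **THE ONE FIELD IS OUTSIDE THE REACH.** The countable perfect field `Ω₁(p) = (𝔽_p(x₀,x₁,…))^{perf}` on which
door 1 is decided (`primeFieldToPerfect_iff_oneField`, res-L1-s82-pv-1 gen 4: the crux `PrimeFieldToPerfect` is
`Res(𝔽_p) ⇒ Res(Ω₁(p))` for every prime) is NOT separably exhausted by finitely generated subfields, so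
`hasResolution_of_fgLevelRes_of_separablyExhausted` says nothing about it: the reach of the half-(a) mechanism and
the residual of the crux are disjoint BY NAME. [cite: Matsumura1987, §26 Thm. 26.4] -/
theorem not_separablyExhausted_oneField (p : ℕ) [Fact p.Prime] (Ω : Type) [Field Ω] [PerfectField Ω]
    [Algebra (FractionRing (MvPolynomial ℕ (ZMod p))) Ω]
    [IsPurelyInseparable (FractionRing (MvPolynomial ℕ (ZMod p))) Ω] [CharP Ω p] :
    ¬ ∀ s : Finset Ω, ∃ (L : Subfield Ω) (t : Finset Ω), L = Subfield.closure (↑t : Set Ω) ∧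
      (↑s : Set Ω) ⊆ L ∧ ∀ u : Finset Ω, LinearIndepOn L _root_.id (↑u : Set Ω) →
        LinearIndepOn L (fun x : Ω => x ^ p) (↑u : Set Ω) :=
  not_separablyExhausted_of_isPurelyInseparable_fractionRing_mvPolynomial p (ZMod p) ℕ Ω

end Summit.ResolutionOfSingularities.ResolutionOfSingularities.Theorems.CampaignW82

end
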